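import Summits.BirchSwinnertonDyer.Rank1Residual.X2.RankOneCertificateExact
import Summits.BirchSwinnertonDyer.Rank1Residual.X2.RankOne
import Literature.NumberTheory.EllipticCurves.Disegni2020.PAdicBSDRankOneNonsplit
import HarnessLib

/-!
# Class X2, rank `1` (sub-cell X2c = residual class O9): the CLASS-CLOSURE sub-partition, the typed
# leading-term statements at `p ‖ N`, and the NON-SPLIT half at main-conjecture level from a
# PUBLISHED theorem (cell `b2b-bsdres`, lane CLASS-CLOSURE, seat `cc-typer-6`)

HONEST FRAMING (run/shared/lean/b2b/bsd-rank1-residual/, verbatim in every file): the goal of the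
cell is to DELETE the COMBINATION-SHAPED residual classes of the Birch–Swinnerton-Dyer formula for
ALL analytic-rank `≤ 1` elliptic curves over `ℚ` — "full BSD formula for every rank `≤ 1` curve in
class `C`" assembled STRICTLY from published theorems — so that the rank-`≤ 1` remainder becomes
exactly the CONSTRUCTION-SHAPED classes, which are TYPED (missing-input `Prop`s), NOT attempted.
This is not "finishing BSD". Research routes; NO CLAIM BEYOND STATED CLASSES; census output is
EVIDENCE, never a Literature fact; nothing here changes a label; X2c stays CONSTRUCTION-SHAPED until
the referee rules. Definitions = the sub-partition predicates and two typed statements (nothing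
asserted); theorems over the tree's existing PUBLISHED named facts BY NAME plus ONE newly vendored
published theorem (`Disegni2020.padicBSD_rankOne_nonsplitMult`, Kyoto J. Math. 60 (2020) Thm. 4).

## Class O9 (RESIDUAL-MAP §I; CLASS-CLOSURE-PLAN §3.7) = `X2.CellC W p := r_an = 1 ∧ ClassX2 W p`
(`p` odd, `E[p]` reducible, `p ‖ N`; sweep 12 665 pairs, 12 106 at `p = 3`; window 373 ‖ 705).

### (b) OBSTRUCTION ANATOMY → SUB-PARTITION (tree predicates only: `CellC`, the split / non-split
### bit `W.HasSplitMultiplicativeReductionAtPrime p`, the Greenberg–Vatsal parity `GVPar W p`)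

| sub-cell (def below) | neighbouring PUBLISHED proof, the hypothesis that FAILS on X2c, and what replaces it | closing statement in the kernel |
|---|---|---|
| `CellCNonsplitGV` (ψ odd, `a_p = −1`) | Perrin-Riou 1987 Cor. 1.8 (leading terms; fails `p ∤ N`) ↦ **Disegni 2020 Thm. 4** (non-split `p ‖ N`, any image: HOLDS); Skinner 2016 Thm. A (MC; fails (irr)+(ram)) ↦ Greenberg–Vatsal 2000 at `p ‖ N` (`GVPar`: HOLDS, flag `GV00-mult-asserted`) | **`bsdp_of_cellC_of_not_split_of_gvPar_of_schneider`: BSD(E,p) modulo the per-pair SCHNEIDER CERTIFICATE only** — VERBATIM-EXTENSION PART, to provers/instruments (certificate `ord_{T=0} L_p(E,T) = 1`, no height, no Heegner point) |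
| `CellCNonsplitNotGV` (ψ even, `a_p = −1`) | as above for the leading terms; MC: GV fails (parity) ↦ route G per pair (`mazurMainConjectureAt_of_coveredRelative_of_not_split`: CGS 2025 Thm. A on a congruent good relative + one λ-certificate; 224/254 window pairs at `3` have a covered relative below 2·10⁴) | `bsdp_of_cellC_of_not_split_of_mazurMainConjectureAt_of_schneider`: BSD(E,p) ⇐ Mazur's MC at the pair + Schneider certificate; irreducible residue = Mazur's MC at a non-split multiplicative Eisenstein pair of this parity (`X2.MazurMainConjectureAt`, typed) — OR the anticyclotomic display alone (`bsdp_of_cellC_of_not_gvPar_of_rankOneDisplay`, partner CLOSED in X2a) |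
| `CellCSplitGV` (ψ odd, `a_p = +1`) | Perrin-Riou ↦ exceptional-zero leading term: in print ONLY up to `ℚ^×` or under "`E[p]` irreducible" (Disegni Thm. 4 second clause ⇐ Venerucci 2016, `p ≥ 5`): FAILS (reducible); MC: GV HOLDS (flag) | `bsdp_of_cellC_of_split_of_mazurMainConjectureAt_of_exceptionalLeadingTerm` with `hMC` from GV: BSD(E,p) ⇐ Schneider certificate + the typed `O9.ExceptionalLeadingTermAt` (EVIDENCE: census 453/453) — irreducible residue = the exact exceptional-zero rank-one leading term for reducible `E[p]` |
| `CellCSplitNotGV` (ψ even, `a_p = +1`) | leading term as above (FAILS); MC: nothing in print or per pair at a split prime (route G is non-split only) | BSD(E,p) ⇐ `X2.MazurMainConjectureAt` + Schneider + `O9.ExceptionalLeadingTermAt`; or the anticyclotomic display alone (partner CLOSED) — both residues CONSTRUCTION |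

Exhaustive and disjoint: `cellC_cases`. The anticyclotomic route (CGLS 2022 Thm. 5.3.1 shape at `p ‖ N`:
`X2.RankOneDisplay` / `X2.HeegnerIndexIdentity`, Keller–Yin Thm. 5.0.4 PRE + control + BDP at `p ‖ N`,
"written by no one") is UNCHANGED by this file and remains the route on the ψ-even cells.

### (a) STATEMENT DISCOVERY — typed targets with their evidence
* `O9.LeadingTermNonsplitAt W p` — the class-wide form of the per-pair certificate `hordL ∧ hcert` of
  `certificate_iff_schneider_and_bsdp_of_mazurMainConjectureAt_nonsplit` modulo Schneider. A THEOREM in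
  print: `leadingTermNonsplitAt_of_disegni` derives it from the vendored fact. Census (instrumentation,
  not a proof): bsd-formula-census X11-REPORT v3 (2026-08-21T04:22Z, `run/shared/lean/ttrl/bsd-formula-
  census/X11-REPORT.md`; fit `x11/N1000/FIT_j115014.json` sha256-16 `893f2842`), cell `r1_nonsplit`:
  `L_p′(E,𝟙)/(Reg_p·Ш_an∏c_ℓ/#T²) = (1 − ã⁻¹)·c_∞ = 2c_∞` on 507/507 pairs (train 332, HELD-OUT 175/175),
  including all 6 pairs with reducible `E[3]` (image 3B, "outside census3"); LEADERBOARD status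
  `claimed` (second scorer pending, PLAN §1 2h).
* `O9.ExceptionalLeadingTermAt W p` (`@[conjecture]`) — the split twin (`ord_{T=0} L = 2`,
  `ord_p(ϖ·[T²]L·log_p(γ)²·#tors²) = ord_p(𝓛_p·∏c·Reg_p) + ord_p #Ш_an`), STATED in print as the
  exceptional case of the Mazur–Tate–Teitelbaum `p`-adic BSD conjecture (MTT 1986 §II.10; Disegni 2020
  Conj. (BSD_p) with `r̃ = 2`); a theorem in print only for irreducible `E[p]`, `p ≥ 5`, with a second
  multiplicative prime (Disegni Thm. 4 ⇐ Venerucci 2016) — NOT on X2. EVIDENCE: X11-REPORT v3 cell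
  `r1_split`: `(L_p″(E,𝟙)/2)/(Reg_p·Ш_an∏c_ℓ/#T²) = 𝓛_p·c_∞` on 453/453 (train 294, HELD-OUT 159/159),
  including all 18 pairs with reducible `E[3]`; status `claimed`. Nothing asserted.

### (c) TRANSPORT (kernel statements already in the tree; cited, not restated)
* isogeny — Cassels: `X2.bsdp_of_isIsogenous_of_bsdp`, `X2.CellC.of_isIsogenous` (`X2/RankOneManin.lean`):
  an isogeny NEVER leaves X2c (the class predicate is isogeny-invariant); it changes only the per-pair
  certificate data (`#Ш_an`, `c_p`, `#tors`, Manin) — instrumentation, not closure;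
* quadratic twist — `classX2_twist`, `pPartRankZero_twist_of_not_gvPar` (`X2/RankOne.lean`): the
  CGLS partner `E^K` is X2 ∩ {r = 0} of the OPPOSITE parity, CLOSED (X2a) iff `¬GVPar W p`; the transport
  statement needed is the display `X2.RankOneDisplay` (typed);
* level-lowering congruence — route G (`X2/CongruenceTransfer*.lean`): Mazur's MC at a NON-split X2
  pair from a congruent covered relative + λ-certificate; composes with
  `bsdp_of_cellC_of_not_split_of_mazurMainConjectureAt_of_schneider` below (rank one now reachable);
* base change — none in print at an Eisenstein `p ‖ N`.

POINTER (not this class): the vendored fact is image-agnostic, so the same composition serves X11b ∩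
{non-split} (N8/O2) with Skinner 2016 Thm. A ((ram)) in place of `hMC` — `Typed.X11.bsdp_of_thmA_nonsplit_
of_certificate`'s `hcert` becomes a theorem modulo Schneider; handed to cc-typer-3 / x11b3 in TYPING.md.

References: [Disegni2020] Thm. 4, Conj. (BSD_p); [Disegni2017] Thm. B; [MazurTateTeitelbaum1986Invent]
§II.10; [SteinWuthrich2013] Thm. 6.1, §4.2; [GreenbergVatsal2000] Thm. (1.3), pp. 14–15; [Wuthrich2014]
Thm. 16; [CastellaGrossiSkinner2025] Thm. A; [CastellaEtAl2021] Thm. 5.3.1; [Venerucci2015] p. 2;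
[Miller2011LMS] Def. 1.1; CLASS-CLOSURE-PLAN.md §3.7; RESIDUAL-MAP.md §I O9, §C.
-/

set_option autoImplicit false

noncomputable section

open scoped Classical MatrixGroups ModularForm

open PowerSeries CongruenceSubgroup WeierstrassCurve Literature.NumberTheory.EllipticCurves
  Literature.NumberTheory.EllipticCurves.ModularForms
  Literature.NumberTheory.EllipticCurves.Rank1Residual
  Literature.NumberTheory.EllipticCurves.Rank1Residual.Typed
  Literature.NumberTheory.EllipticCurves.GreenbergVatsal2000
  Literature.NumberTheory.EllipticCurves.Wuthrich2014
  Literature.NumberTheory.EllipticCurves.SteinWuthrich2013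
  Literature.NumberTheory.EllipticCurves.Disegni2020

namespace Summit.BirchSwinnertonDyer.Rank1Residual.X2

/-! ## §1. The sub-partition of X2c (O9): split / non-split × Greenberg–Vatsal parity -/

section SubPartition

variable (W : WeierstrassCurve ℚ) (p : ℕ) [Fact p.Prime]

/-- **O9 sub-cell: non-split multiplicative `p`, GV parity (ψ odd).** `CellC W p`, `¬` split, `GVPar W p`.
Mazur's MC at the pair is Greenberg–Vatsal's (flag `GV00-mult-asserted`); the rank-one leading term is
Disegni 2020 Thm. 4: closed modulo the Schneider certificate
(`bsdp_of_cellC_of_not_split_of_gvPar_of_schneider`). [folklore] -/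
def CellCNonsplitGV : Prop :=
  CellC W p ∧ ¬ W.HasSplitMultiplicativeReductionAtPrime p ∧ GVPar W p

/-- **O9 sub-cell: non-split multiplicative `p`, the other parity (ψ even; partner `E^K` in the
CLOSED sub-cell X2a).** Mazur's MC per pair by route G, or the anticyclotomic display. [folklore] -/
def CellCNonsplitNotGV : Prop :=
  CellC W p ∧ ¬ W.HasSplitMultiplicativeReductionAtPrime p ∧ ¬ GVPar W p

/-- **O9 sub-cell: split multiplicative `p` (exceptional zero), GV parity (ψ odd).** MC from
Greenberg–Vatsal (flag); leading term = the typed `O9.ExceptionalLeadingTermAt`. [folklore] -/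
def CellCSplitGV : Prop :=
  CellC W p ∧ W.HasSplitMultiplicativeReductionAtPrime p ∧ GVPar W p

/-- **O9 sub-cell: split multiplicative `p`, the other parity (ψ even; partner CLOSED).** Both the MC
at the pair and the exceptional leading term are typed inputs; or the display alone. [folklore] -/
def CellCSplitNotGV : Prop :=
  CellC W p ∧ W.HasSplitMultiplicativeReductionAtPrime p ∧ ¬ GVPar W p

/-- The four O9 sub-cells EXHAUST X2c (excluded middle on the split bit and on `GVPar`). [folklore] -/
theorem cellC_cases (hc : CellC W p) :
    CellCNonsplitGV W p ∨ CellCNonsplitNotGV W p ∨ CellCSplitGV W p ∨ CellCSplitNotGV W p := by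
  by_cases hs : W.HasSplitMultiplicativeReductionAtPrime p
  · by_cases hg : GVPar W p
    · exact Or.inr (Or.inr (Or.inl ⟨hc, hs, hg⟩))
    · exact Or.inr (Or.inr (Or.inr ⟨hc, hs, hg⟩))
  · by_cases hg : GVPar W p
    · exact Or.inl ⟨hc, hs, hg⟩
    · exact Or.inr (Or.inl ⟨hc, hs, hg⟩)

/-- The four O9 sub-cells are pairwise disjoint (bookkeeping). [folklore] -/
theorem cellC_subcells_disjoint :
    ¬ (CellCNonsplitGV W p ∧ CellCNonsplitNotGV W p) ∧ ¬ (CellCNonsplitGV W p ∧ CellCSplitGV W p) ∧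
    ¬ (CellCNonsplitGV W p ∧ CellCSplitNotGV W p) ∧ ¬ (CellCNonsplitNotGV W p ∧ CellCSplitGV W p) ∧
    ¬ (CellCNonsplitNotGV W p ∧ CellCSplitNotGV W p) ∧ ¬ (CellCSplitGV W p ∧ CellCSplitNotGV W p) :=
  ⟨fun ⟨h₁, h₂⟩ ↦ h₂.2.2 h₁.2.2, fun ⟨h₁, h₂⟩ ↦ h₁.2.1 h₂.2.1, fun ⟨h₁, h₂⟩ ↦ h₁.2.1 h₂.2.1,
    fun ⟨h₁, h₂⟩ ↦ h₁.2.1 h₂.2.1, fun ⟨h₁, h₂⟩ ↦ h₁.2.1 h₂.2.1, fun ⟨h₁, h₂⟩ ↦ h₂.2.2 h₁.2.2⟩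

/-- Each sub-cell lies in X2c (projections, for consumers). [folklore] -/
theorem cellC_of_subcell :
    (CellCNonsplitGV W p → CellC W p) ∧ (CellCNonsplitNotGV W p → CellC W p) ∧
    (CellCSplitGV W p → CellC W p) ∧ (CellCSplitNotGV W p → CellC W p) :=
  ⟨fun h ↦ h.1, fun h ↦ h.1, fun h ↦ h.1, fun h ↦ h.1⟩

end SubPartition

/-! ## §2. The typed leading-term statements at `p ‖ N`, rank one (experiment type (1)) -/

namespace O9

/-- **TYPED STATEMENT (non-split): the rank-one `p`-adic leading-term identity at a non-split
multiplicative prime, class-wide form of the per-pair certificate** — for the cyclotomic `(κ, γ)`,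
every newform `f` of `W`, `ϖ` with `ϖ·Ω(W) = Ω⁺_f`, THE non-split Mazur–Tate–Teitelbaum function `L`,
the Tate parameter `q`, THE Stein–Wuthrich §4.2 height `Dh` and `s = #Ш(E/ℚ)_an`: if
`Reg_p(E,Dh) ≠ 0` then `ord_{T=0} L = 1` and
`ord_p(ϖ·[T¹]L·log_p(γ_cyc)·#tors²) = ord_p(2·∏c·Reg_p(E,Dh)) + ord_p s`. A `Prop` on `(W,p)`; nothing
asserted here. At analytic rank one it is a THEOREM in print (Disegni 2020 Thm. 4 first clause, any
image of `E[p]`): `leadingTermNonsplitAt_of_disegni`. CENSUS EVIDENCE (instrumentation only; status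
`claimed`, second scorer pending): X11-REPORT v3 cell `r1_nonsplit`, survivor `(1 − ã⁻¹)·c_∞`, 507/507,
held-out 175/175, incl. 6/6 pairs with reducible `E[3]` (fit `FIT_j115014.json`, sha256-16 `893f2842`).
[cite: Disegni2020, Thm. 4 (§3.2) with Conj. (BSD_p) (§1.1.4)] [cite: MazurTateTeitelbaum1986Invent, §II.10]
[cite: SteinWuthrich2013, §4.2 and Thm. 6.1] -/
def LeadingTermNonsplitAt (W : WeierstrassCurve ℚ) [W.IsElliptic] [W.IsGloballyMinimal] (p : ℕ)
    [Fact p.Prime] : Prop :=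
  ∀ (κ : ZpExtension ℚ p) (γ : Field.absoluteGaloisGroup ℚ),
      κ.IsCyclotomic → κ.IsTopGenerator γ → IsCyclotomicVariable p γ →
    ∀ ⦃N : ℕ⦄ [NeZero N] (f : CuspForm (Gamma0 N) 2), IsNewformOf W f →
    ∀ (ϖ : ℚ), (ϖ : ℝ) * W.realPeriodRat = plusPeriod f →
    ∀ (L : PowerSeries ℚ_[p]), IsMultPAdicLFunctionOf f p (-1) L →
    ∀ (q : ℚ_[p]), q ≠ 0 → ‖q‖ < 1 → tateJ q = (W.j : ℚ_[p]) →
    ∀ (Dh : PAdicHeightData W p), IsMultCanonical Dh q → ∀ (s : ℚ), shaAn W = (s : ℂ) →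
      padicRegulator Dh ≠ 0 →
        L.order = ((1 : ℕ) : ℕ∞) ∧
        (((ϖ : ℚ) : ℚ_[p]) * PowerSeries.coeff 1 L *
            (padicLog p (cyclotomicGenerator p) ^ 1 * (W.torsionOrder : ℚ_[p]) ^ 2)).valuation =
          (2 * (W.tamagawaProduct : ℚ_[p]) * padicRegulator Dh).valuation + padicValRat p s

/-- **TYPED CONJECTURED TARGET (split, exceptional zero): the rank-one `p`-adic leading-term identity
at a SPLIT multiplicative prime, class-wide form of the per-pair certificate** — for THE split
Mazur–Tate–Teitelbaum function `L`, the Tate parameter datum `Dq`, THE §4.2 (modified) height `Dh` and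
`s = #Ш(E/ℚ)_an`: if `Reg_p(E,Dh) ≠ 0` then `ord_{T=0} L = 2` and
`ord_p(ϖ·[T²]L·log_p(γ_cyc)²·#tors²) = ord_p(𝓛_p·∏c·Reg_p(E,Dh)) + ord_p s`. STATED in print as the
exceptional case of the `p`-adic Birch–Swinnerton-Dyer conjecture (Mazur–Tate–Teitelbaum 1986 §II.10;
Disegni 2020 Conj. (BSD_p), `r̃ = r + 1 = 2`); a THEOREM in print only for `E[p]` irreducible,
`p ≥ 5`, with a second multiplicative prime (Disegni 2020 Thm. 4 second clause ⇐ Venerucci 2016,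
whose standing hypothesis is irreducibility) — hence OPEN on class X2 (reducible `E[p]`): the
IRREDUCIBLE RESIDUE of the split half of O9 on the cyclotomic route. CENSUS EVIDENCE (instrumentation;
status `claimed`): X11-REPORT v3 cell `r1_split`, survivor `𝓛_p·c_∞`, 453/453, held-out 159/159,
incl. 18/18 pairs with reducible `E[3]`; `Ш_an` exponent `k = 1` read on 2/2 pairs with `Ш_an = 4`.
A `Prop`; nothing asserted. [cite: MazurTateTeitelbaum1986Invent, §II.10 (the conjecture BSD(p), exceptional case)]
[cite: Disegni2020, Conj. (BSD_p) (§1.1.4) and Thm. 4 second clause (§3.2.2)]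
[cite: SteinWuthrich2013, §4.2 and Thm. 6.1] -/
@[conjecture] def ExceptionalLeadingTermAt (W : WeierstrassCurve ℚ) [W.IsElliptic] [W.IsGloballyMinimal]
    (p : ℕ) [Fact p.Prime] : Prop :=
  ∀ (κ : ZpExtension ℚ p) (γ : Field.absoluteGaloisGroup ℚ),
      κ.IsCyclotomic → κ.IsTopGenerator γ → IsCyclotomicVariable p γ →
    ∀ ⦃N : ℕ⦄ [NeZero N] (f : CuspForm (Gamma0 N) 2), IsNewformOf W f →
    ∀ (ϖ : ℚ), (ϖ : ℝ) * W.realPeriodRat = plusPeriod f →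
    ∀ (L : PowerSeries ℚ_[p]), IsSplitMultPAdicLFunctionOf f p L →
    ∀ (Dq : TateParameterData W p) (Dh : PAdicHeightData W p), IsSplitMultCanonical Dh Dq →
    ∀ (s : ℚ), shaAn W = (s : ℂ) →
      padicRegulator Dh ≠ 0 →
        L.order = ((2 : ℕ) : ℕ∞) ∧
        (((ϖ : ℚ) : ℚ_[p]) * PowerSeries.coeff 2 L *
            (padicLog p (cyclotomicGenerator p) ^ 2 * (W.torsionOrder : ℚ_[p]) ^ 2)).valuation =
          (LInvariant Dq * (W.tamagawaProduct : ℚ_[p]) * padicRegulator Dh).valuation + padicValRat p s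

/-- **The non-split statement is a theorem in print**: at a pair with `p ≠ 2` of non-split
multiplicative reduction and `ord_{s=1} L(E,s) = 1`, `O9.LeadingTermNonsplitAt W p` follows from the
vendored fact `Disegni2020.padicBSD_rankOne_nonsplitMult` (Disegni 2020 Thm. 4, first clause). No
image hypothesis. [cite: Disegni2020, Thm. 4 (§3.2) with Conj. (BSD_p) (§1.1.4)] -/
theorem leadingTermNonsplitAt_of_disegni (hDis : padicBSD_rankOne_nonsplitMult)
    (W : WeierstrassCurve ℚ) [W.IsElliptic] [W.IsGloballyMinimal] (p : ℕ) [Fact p.Prime]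
    (hp2 : p ≠ 2) (hmult : W.HasMultiplicativeReductionAtPrime p)
    (hns : ¬ W.HasSplitMultiplicativeReductionAtPrime p) (hr : W.analyticRank = 1) :
    LeadingTermNonsplitAt W p :=
  fun κ γ hκ hγ hγ' _ _ f hf ϖ hϖ L hL q hq0 hq1 hqj Dh hDh s hs hReg ↦
    (hDis W p hp2 hmult hns hr κ γ hκ hγ hγ' f hf ϖ hϖ L hL q hq0 hq1 hqj Dh hDh s hs).2 hReg

end O9

/-! ## §3. Rationality of `#Ш_an` at analytic rank one (bookkeeping from Gross–Zagier) -/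

/-- At analytic rank one Miller's `#Ш(E/ℚ)_an` is a rational number: Gross–Zagier I.(7.3) gives
`L'(E,1) = c·Ω·Reg` with `c ∈ ℚ` (`hGZ`; `rank = 1` by GZK `hGZK`), so `#Ш_an = c·#tors²/∏c`.
[cite: GrossZagier1986, Thm. I.(7.3) 2)] [cite: Miller2011LMS, §1 (arXiv:1010.2431 p. 3)] -/
theorem exists_rat_shaAn_eq_of_analyticRank_eq_one (hGZ : GrossZagier1986_thm_I_7_3)
    (hGZK : rank_eq_analyticRank_of_analyticRank_le_one)
    (W : WeierstrassCurve ℚ) [W.IsElliptic] [W.IsGloballyMinimal] (hr : W.analyticRank = 1) :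
    ∃ s : ℚ, shaAn W = (s : ℂ) := by
  have hrk : W.mordellWeilRank = 1 := by rw [(hGZK W hr.le).1, hr]
  obtain ⟨c, -, hc⟩ := leadingLCoeff_eq_rat_mul_of_analyticRank_eq_one (W := W) hGZ hr hrk
  refine ⟨c * (W.torsionOrder : ℚ) ^ 2 / W.tamagawaProduct, ?_⟩
  have hΩ : (W.realPeriodRat : ℂ) ≠ 0 := by exact_mod_cast (W.realPeriodRat_pos_holds).ne'
  have hR : (W.regulator : ℂ) ≠ 0 := by exact_mod_cast (W.regulator_pos').ne'
  have hc0 : (W.tamagawaProduct : ℂ) ≠ 0 := by exact_mod_cast (W.tamagawaProduct_pos').ne'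
  rw [shaAn_def, hc]
  push_cast
  field_simp

/-! ## §4. The NON-SPLIT half of O9 at main-conjecture level, from the published record -/

section Nonsplit

variable (W : WeierstrassCurve ℚ) [W.IsElliptic] [W.IsGloballyMinimal] (p : ℕ) [Fact p.Prime]

/-- **X2c, NON-SPLIT `p`: Mazur's main conjecture at the pair + the Schneider certificate ⟹ `BSD(E,p)`,
from PUBLISHED facts** — the rank-one twin of `bsdp_of_mazurMainConjectureAt_of_analyticRank_eq_zero`.
Inputs: the vendored Disegni 2020 Thm. 4 (`hDis`, leading terms at non-split `p ‖ N`, any image),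
Stein–Wuthrich 2013 Thm. 6.1 (`hJn`, Jones' algebraic leading term), the §4.2 height existence (`hHn`),
Gross–Zagier (`hGZ`, rationality of `#Ш_an`), Gross–Zagier–Kolyvagin (`hGZK`), modularity (`hpar`);
the cyclotomic data, `X(E/ℚ_∞)`, the newform and `ϖ`, THE non-split Mazur–Tate–Teitelbaum function
(`exists_isMultPAdicLFunctionOf_neg_one_of_nonsplit`) and the Tate parameter are INSTANTIATED from tree
theorems; then eisenstein-p2's exactness `certificate_iff_schneider_and_bsdp_of_mazurMainConjectureAt_
nonsplit`. `hMC` is per pair route G (`mazurMainConjectureAt_of_coveredRelative_of_not_split`) on the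
ψ-even sub-cell and Greenberg–Vatsal on the ψ-odd one (next theorem). The per-pair binder `hSch` is
Schneider's non-degeneracy of THE §4.2 height (class-wide Schneider's conjecture; per pair a finite
`p`-adic certificate, e.g. `ord_{T=0} L_p(E,T) = 1`). [cite: Disegni2020, Thm. 4 (§3.2)]
[cite: SteinWuthrich2013, Thm. 6.1 (p. 20), §3.1 (p. 9), §4.2] [cite: Miller2011LMS, Def. 1.1 and Prop. 7.6] -/
theorem bsdp_of_cellC_of_not_split_of_mazurMainConjectureAt_of_schneider
    (hDis : padicBSD_rankOne_nonsplitMult) (hJn : thm61_nonsplitMultiplicative)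
    (hHn : exists_isMultCanonical) (hGZ : GrossZagier1986_thm_I_7_3)
    (hGZK : rank_eq_analyticRank_of_analyticRank_le_one) (hpar : nonempty_modularParametrizationData)
    (hc : CellC W p) (hns : ¬ W.HasSplitMultiplicativeReductionAtPrime p)
    (hMC : MazurMainConjectureAt W p)
    (hSch : ∀ (q : ℚ_[p]) (Dh : PAdicHeightData W p), q ≠ 0 → ‖q‖ < 1 → tateJ q = (W.j : ℚ_[p]) →
      IsMultCanonical Dh q → SchneiderConjecture Dh) :
    BSDp W p := by
  obtain ⟨hr1, hp2, -, hmult⟩ := hc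
  obtain ⟨κ, hκ, γ, hγ, hγ'⟩ := exists_isCyclotomic_isTopGenerator_isCyclotomicVariable_holds p
  obtain ⟨D⟩ := W.nonempty_selmerDualData_holds κ γ hγ
  haveI : NeZero (W.conductorNorm ℤ) := ⟨(W.conductorNorm_pos_holds).ne'⟩
  obtain ⟨Dm⟩ := hpar W
  obtain ⟨ϖ, hϖpos, hϖ, -⟩ := Dm.exists_rat_mul_realPeriodRat_eq_plusPeriod
  obtain ⟨L, hL⟩ := exists_isMultPAdicLFunctionOf_neg_one_of_nonsplit Dm.isNewformOf hmult hns
  obtain ⟨q, ⟨hq0, hq1, hqj⟩, -⟩ := existsUnique_tateJ_eq_of_one_lt_norm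
    (one_lt_norm_j_of_hasMultiplicativeReductionAtPrime (W := W) (p := p) hmult)
  obtain ⟨Dh, hDh⟩ := hHn W p hp2 hmult hns q hq0 hq1 hqj
  obtain ⟨s, hs⟩ := exists_rat_shaAn_eq_of_analyticRank_eq_one hGZ hGZK W hr1
  have hrank : W.mordellWeilRank = 1 := by rw [(hGZK W hr1.le).1, hr1]
  have hReg : padicRegulator Dh ≠ 0 := hSch q Dh hq0 hq1 hqj hDh
  obtain ⟨hord, hval⟩ :=
    (hDis W p hp2 hmult hns hr1 κ γ hκ hγ hγ' Dm.f Dm.isNewformOf ϖ hϖ L hL q hq0 hq1 hqj Dh hDh s hs).2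
      hReg
  exact ((certificate_iff_schneider_and_bsdp_of_mazurMainConjectureAt_nonsplit hJn hGZK W p hp2 hr1.le
    hMC hmult hns hq0 hq1 hqj hDh hκ hγ hγ' Dm.isNewformOf D ϖ hϖpos.ne' hϖ L hL hs).mp
      ⟨by rw [hrank]; exact hord, by rw [hrank]; simpa using hval⟩).2

/-- **O9 sub-cell `CellCNonsplitGV` (X2c, non-split `p`, GV parity): `BSD(E,p)` from PUBLISHED facts
MODULO THE PAIR'S SCHNEIDER CERTIFICATE ONLY** — Mazur's MC at the pair is Greenberg–Vatsal's at a
multiplicative prime (`hGV`, flag `GV00-mult-asserted`, + Wuthrich Thm. 16 `hWu`, gen 1's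
`mazurMainConjectureAt_of_gvPar`), the leading term is Disegni 2020 Thm. 4 (`hDis`). The VERBATIM-
EXTENSION part of class O9 (census: the 138 ψ-odd X2c window pairs, non-split share): same status as
N1′ (type-B anomalous, COVERED modulo Schneider). No Heegner point, no anticyclotomic input, no
preprint. [cite: Disegni2020, Thm. 4 (§3.2)] [cite: GreenbergVatsal2000, Thm. (1.3) with pp. 1, 14–15]
[cite: Wuthrich2014, Thm. 16 (p. 397)] [cite: SteinWuthrich2013, Thm. 6.1 (p. 20), §3.1 (p. 9), §4.2] -/
theorem bsdp_of_cellC_of_not_split_of_gvPar_of_schneider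
    (hDis : padicBSD_rankOne_nonsplitMult) (hGV : lambdaMu_multiplicative_of_gvPar)
    (hWu : thm16_charIdeal_dvd_multiplicative_of_reducible) (hJn : thm61_nonsplitMultiplicative)
    (hHn : exists_isMultCanonical) (hGZ : GrossZagier1986_thm_I_7_3)
    (hGZK : rank_eq_analyticRank_of_analyticRank_le_one) (hpar : nonempty_modularParametrizationData)
    (hc : CellCNonsplitGV W p)
    (hSch : ∀ (q : ℚ_[p]) (Dh : PAdicHeightData W p), q ≠ 0 → ‖q‖ < 1 → tateJ q = (W.j : ℚ_[p]) →
      IsMultCanonical Dh q → SchneiderConjecture Dh) :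
    BSDp W p :=
  bsdp_of_cellC_of_not_split_of_mazurMainConjectureAt_of_schneider W p hDis hJn hHn hGZ hGZK hpar hc.1
    hc.2.1 (mazurMainConjectureAt_of_gvPar hGV hWu W p hc.1.2.1 hc.1.2.2.2 hc.2.2) hSch

/-- **O9's NON-SPLIT half in one line**: on `CellC ∧ ¬split`, `BSD(E,p)` holds modulo the pair's
Schneider certificate as soon as Mazur's MC holds at the pair — which is PUBLISHED on the GV-parity
sub-cell and per-pair-certified (route G) on the other; the disjunction form consumed by the class
ledger. [cite: Disegni2020, Thm. 4 (§3.2)] [cite: GreenbergVatsal2000, Thm. (1.3) with pp. 1, 14–15] -/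
theorem bsdp_of_cellC_of_not_split_of_gvPar_or_mazurMainConjectureAt_of_schneider
    (hDis : padicBSD_rankOne_nonsplitMult) (hGV : lambdaMu_multiplicative_of_gvPar)
    (hWu : thm16_charIdeal_dvd_multiplicative_of_reducible) (hJn : thm61_nonsplitMultiplicative)
    (hHn : exists_isMultCanonical) (hGZ : GrossZagier1986_thm_I_7_3)
    (hGZK : rank_eq_analyticRank_of_analyticRank_le_one) (hpar : nonempty_modularParametrizationData)
    (hc : CellC W p) (hns : ¬ W.HasSplitMultiplicativeReductionAtPrime p)
    (hMC : GVPar W p ∨ MazurMainConjectureAt W p)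
    (hSch : ∀ (q : ℚ_[p]) (Dh : PAdicHeightData W p), q ≠ 0 → ‖q‖ < 1 → tateJ q = (W.j : ℚ_[p]) →
      IsMultCanonical Dh q → SchneiderConjecture Dh) :
    BSDp W p := by
  rcases hMC with hgv | hMC
  · exact bsdp_of_cellC_of_not_split_of_gvPar_of_schneider W p hDis hGV hWu hJn hHn hGZ hGZK hpar
      ⟨hc, hns, hgv⟩ hSch
  · exact bsdp_of_cellC_of_not_split_of_mazurMainConjectureAt_of_schneider W p hDis hJn hHn hGZ hGZK
      hpar hc hns hMC hSch

end Nonsplit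

/-! ## §5. The SPLIT half of O9 at main-conjecture level, modulo the typed exceptional leading term -/

section Split

variable (W : WeierstrassCurve ℚ) [W.IsElliptic] [W.IsGloballyMinimal] (p : ℕ) [Fact p.Prime]

/-- **X2c, SPLIT `p`: Mazur's MC at the pair + the Schneider certificate + the TYPED exceptional
leading term (`O9.ExceptionalLeadingTermAt W p`, nothing asserted) ⟹ `BSD(E,p)`** — how experiment
type (1)'s split statement feeds the class theorem: the data are instantiated from tree theorems
(`exists_isSplitMultPAdicLFunctionOf`, `nonempty_tateParameterData_iff_holds`, height existence
`hHs`), then `certificate_iff_schneider_and_bsdp_of_mazurMainConjectureAt_split` (Jones `hJs`,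
`𝓛_p ≠ 0` proved). The residue named for ideation is exactly `hExc` (for reducible `E[p]`).
[cite: SteinWuthrich2013, Thm. 6.1 (p. 20) and §4.2] [cite: MazurTateTeitelbaum1986Invent, §II.10]
[cite: Miller2011LMS, Def. 1.1 and Prop. 7.6] -/
theorem bsdp_of_cellC_of_split_of_mazurMainConjectureAt_of_exceptionalLeadingTerm
    (hJs : thm61_splitMultiplicative) (hHs : exists_isSplitMultCanonical)
    (hGZ : GrossZagier1986_thm_I_7_3) (hGZK : rank_eq_analyticRank_of_analyticRank_le_one)
    (hpar : nonempty_modularParametrizationData)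
    (hc : CellC W p) (hsplit : W.HasSplitMultiplicativeReductionAtPrime p)
    (hMC : MazurMainConjectureAt W p) (hExc : O9.ExceptionalLeadingTermAt W p)
    (hSch : ∀ (Dq : TateParameterData W p) (Dh : PAdicHeightData W p),
      IsSplitMultCanonical Dh Dq → SchneiderConjecture Dh) :
    BSDp W p := by
  obtain ⟨hr1, hp2, -, -⟩ := hc
  obtain ⟨κ, hκ, γ, hγ, hγ'⟩ := exists_isCyclotomic_isTopGenerator_isCyclotomicVariable_holds p
  obtain ⟨D⟩ := W.nonempty_selmerDualData_holds κ γ hγ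
  haveI : NeZero (W.conductorNorm ℤ) := ⟨(W.conductorNorm_pos_holds).ne'⟩
  obtain ⟨Dm⟩ := hpar W
  obtain ⟨ϖ, hϖpos, hϖ, -⟩ := Dm.exists_rat_mul_realPeriodRat_eq_plusPeriod
  obtain ⟨L, hL⟩ := exists_isSplitMultPAdicLFunctionOf hsplit Dm.isNewformOf
  obtain ⟨Dq⟩ := (nonempty_tateParameterData_iff_holds (W := W) (p := p)).mpr hsplit
  obtain ⟨Dh, hDh⟩ := hHs W p hp2 Dq
  obtain ⟨s, hs⟩ := exists_rat_shaAn_eq_of_analyticRank_eq_one hGZ hGZK W hr1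
  have hrank : W.mordellWeilRank = 1 := by rw [(hGZK W hr1.le).1, hr1]
  have hReg : padicRegulator Dh ≠ 0 := hSch Dq Dh hDh
  obtain ⟨hord, hval⟩ := hExc κ γ hκ hγ hγ' Dm.f Dm.isNewformOf ϖ hϖ L hL Dq Dh hDh s hs hReg
  exact ((certificate_iff_schneider_and_bsdp_of_mazurMainConjectureAt_split hJs hGZK W p hp2 hr1.le hMC
    Dq hDh hκ hγ hγ' Dm.isNewformOf D ϖ hϖpos.ne' hϖ L hL hs).mp
      ⟨by rw [hrank]; exact hord, by rw [hrank]; exact hval⟩).2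

/-- **O9 sub-cell `CellCSplitGV` (split `p`, GV parity): `BSD(E,p)` modulo the Schneider certificate
and the typed exceptional leading term**, Mazur's MC being Greenberg–Vatsal's (flag `GV00-mult-asserted`).
[cite: GreenbergVatsal2000, Thm. (1.3) with pp. 1, 14–15] [cite: Wuthrich2014, Thm. 16 (p. 397)]
[cite: SteinWuthrich2013, Thm. 6.1 (p. 20) and §4.2] -/
theorem bsdp_of_cellC_of_split_of_gvPar_of_exceptionalLeadingTerm
    (hGV : lambdaMu_multiplicative_of_gvPar) (hWu : thm16_charIdeal_dvd_multiplicative_of_reducible)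
    (hJs : thm61_splitMultiplicative) (hHs : exists_isSplitMultCanonical)
    (hGZ : GrossZagier1986_thm_I_7_3) (hGZK : rank_eq_analyticRank_of_analyticRank_le_one)
    (hpar : nonempty_modularParametrizationData)
    (hc : CellCSplitGV W p) (hExc : O9.ExceptionalLeadingTermAt W p)
    (hSch : ∀ (Dq : TateParameterData W p) (Dh : PAdicHeightData W p),
      IsSplitMultCanonical Dh Dq → SchneiderConjecture Dh) :
    BSDp W p :=
  bsdp_of_cellC_of_split_of_mazurMainConjectureAt_of_exceptionalLeadingTerm W p hJs hHs hGZ hGZK hpar hc.1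
    hc.2.1 (mazurMainConjectureAt_of_gvPar hGV hWu W p hc.1.2.1 hc.1.2.2.2 hc.2.2) hExc hSch

end Split

end Summit.BirchSwinnertonDyer.Rank1Residual.X2

end
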